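import Summits.QuantumAdvantage.QuantumAdvantage.Theorems.MobiusLadderLiouvilleOrthogonalTC0StubLtfCore
import HarnessLib

/-!
# Crux `MobiusLadder.LiouvilleOrthogonalTC0` (stmt-QuantumAdvantage-1393): the spectral criterion at a
single level

Line `Sketch` (lead `prover-line-stmt-QuantumAdvantage-1393-c2-0`). The sharp generic form of the
engine behind the depth-one and bounded-size rungs: GIVEN a uniform Möbius–Walsh bound for `λ` with
exponent `c` (`|Σ_{N<2ⁿ} λ(N) w_A(bits N)| ≤ 2^{n-n^c}` for all `A`, eventually in `n` — Bourgain's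
theorem, `bourgain_liouville_walsh_holds`, supplies some `c > 0`) and any `R` with `R c ≥ 3`, for every
`ε > 0`, eventually in `n`, EVERY Boolean function `F` of `n` bits whose Fourier tail above the single
level `⌊n^{1/R}⌋₊ + 1` is at most `(ε/3)²` satisfies `|Σ_{N<2ⁿ} λ(N) sgn F(bits N)| ≤ ε 2ⁿ`.

This is the form needed for classes whose tail bounds deteriorate with `n` (e.g. threshold circuits
with `δ log n` gates), where the level must be balanced against the class parameter exactly as in
Green's treatment of `AC⁰`. Proof: `GreenAC0.core_bound` + `LtfCore.low_term_le` (parameters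
`k = ⌊n^{1/R}⌋₊`, `(n+1)^k 2^{n-n^c} ≤ 2ⁿ 2^{-k} ≤ (ε/3) 2ⁿ` once `k ≥ R + 1`, `2^{-k} ≤ ε/3`).
-/

set_option linter.dupNamespace false -- D-0017: single-problem summit ⇒ `QuantumAdvantage.QuantumAdvantage` by design

noncomputable section

namespace Summit.QuantumAdvantage.QuantumAdvantage.Theorems.LiouvilleOrthogonalTC0

open Filter Finset Topology
open Literature.Computability.Complexity
open Literature.Computability.Complexity.LowDegree (tailWeight)
open Literature.Probability.RandomGraphs.LowDegree (sgn walsh walsh_empty)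
open Literature.NumberTheory.Sieve

/-- **The spectral criterion at a single level.** Let `c > 0` and suppose the uniform Walsh bound
`|Σ_{N<2ⁿ} λ(N) w_A(bits N)| ≤ 2^{n-n^c}` holds for all `A`, eventually in `n`; let `R ≥ 1` with
`3 ≤ R c`. Then for every `ε > 0`, for all sufficiently large `n`, every Boolean function `F` of `n`
bits with `W^{≥ ⌊n^{1/R}⌋₊+1}[sgn ∘ F] ≤ (ε/3)²` has `|Σ_{N<2ⁿ} λ(N) · sgn F(bits N)| ≤ ε · 2ⁿ`. -/
theorem liouville_orthogonal_of_tailWeight_level {c : ℝ} (hc : 0 < c)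
    (hB : ∀ᶠ n : ℕ in atTop, ∀ A : Finset (Fin n),
      |∑ x ∈ range (2 ^ n),
          (ArithmeticFunction.liouville x : ℝ) * walsh A (fun j : Fin n => x.testBit j)|
        ≤ (2 : ℝ) ^ ((n : ℝ) - (n : ℝ) ^ c))
    {R : ℕ} (hR1 : 1 ≤ R) (hRc : 3 ≤ (R : ℝ) * c) :
    ∀ ε : ℝ, 0 < ε → ∀ᶠ n : ℕ in atTop, ∀ F : (Fin n → Bool) → Bool,
      tailWeight (fun x : Fin n → Bool => sgn (F x)) (⌊((n : ℝ)) ^ ((1 : ℝ) / R)⌋₊ + 1) ≤ (ε / 3) ^ 2 →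
        |∑ N ∈ Finset.range (2 ^ n), ((ArithmeticFunction.liouville N : ℤ) : ℝ) *
            sgn (F (fun i : Fin n => Nat.testBit N i))| ≤ ε * (2 : ℝ) ^ n := by
  intro ε hε
  have hT := LtfCore.tendsto_floor_rpow hR1
  have hε3 : 0 < ε / 3 := by positivity
  have h1 : ∀ᶠ k : ℕ in atTop, R + 1 ≤ k := eventually_ge_atTop _
  have h2 : ∀ᶠ k : ℕ in atTop, ((2 : ℝ)⁻¹) ^ k ≤ ε / 3 :=
    Filter.Tendsto.eventually_le_const hε3
      (tendsto_pow_atTop_nhds_zero_of_lt_one (by norm_num) (by norm_num))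
  filter_upwards [hB, hT.eventually (h1.and h2)] with n hBn hpar F hF
  obtain ⟨hRk, hηk⟩ := hpar
  set k : ℕ := ⌊((n : ℝ)) ^ ((1 : ℝ) / R)⌋₊ with hkdef
  -- pass to the cube
  rw [MoebiusWalsh.sum_range_two_pow_eq_sum_cube
    (fun N => ((ArithmeticFunction.liouville N : ℤ) : ℝ) * sgn (F (fun i : Fin n => Nat.testBit N i)))]
  simp only [MoebiusWalsh.ofFn_testBit_bitsToNat]
  set f : (Fin n → Bool) → ℝ := fun y => sgn (F y) with hfdef
  set G : (Fin n → Bool) → ℝ := fun y =>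
    ((ArithmeticFunction.liouville (bitsToNat (List.ofFn y)) : ℤ) : ℝ) with hGdef
  have hG : ∀ y, |G y| ≤ 1 := fun y =>
    Literature.NumberTheory.LFunctions.LiouvilleSum.abs_liouville_le_one _
  have hf : ∀ y, |f y| ≤ 1 := fun y => by
    simp only [hfdef]; unfold sgn; split_ifs <;> simp
  -- the Walsh bound on the cube, for every character
  set B : ℝ := (2 : ℝ) ^ ((n : ℝ) - (n : ℝ) ^ c) with hBdef
  have hWalsh : ∀ A : Finset (Fin n), |∑ y, G y * walsh A y| ≤ B := by
    intro A
    have h := hBn A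
    rw [MoebiusWalsh.sum_range_two_pow_eq_sum_cube
      (fun N => (ArithmeticFunction.liouville N : ℝ) * walsh A (fun j : Fin n => N.testBit j))] at h
    simp only [MoebiusWalsh.ofFn_testBit_bitsToNat] at h
    exact h
  have h0 : |∑ y, G y| ≤ B := by simpa using hWalsh ∅
  have hB0 : 0 ≤ B := by positivity
  have hcore := GreenAC0.core_bound (k := k) f G hf hG (E₀ := B) (E₁ := B)
    (τ := (ε / 3) ^ 2) hB0 h0 (fun S _ _ => hWalsh S) hF
  change |∑ y, G y * f y| ≤ ε * 2 ^ n
  refine hcore.trans ?_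
  have hkn : k ^ R ≤ n := LtfCore.floor_rpow_pow_le hR1 n
  have hnk : n < (k + 1) ^ R := LtfCore.lt_floor_rpow_succ_pow hR1 n
  have hlow : ((n : ℝ) + 1) ^ k * B ≤ ε / 3 * 2 ^ n := LtfCore.low_term_le hc hRc hkn hnk hRk hηk
  have hE0 : B ≤ ε / 3 * 2 ^ n := by
    refine le_trans ?_ hlow
    refine le_mul_of_one_le_left hB0 ?_
    exact one_le_pow₀ (by linarith [(Nat.cast_nonneg n : (0 : ℝ) ≤ n)])
  have hsqrt : Real.sqrt ((ε / 3) ^ 2) = ε / 3 := Real.sqrt_sq hε3.le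
  rw [hsqrt] at hcore ⊢
  have htail : (2 : ℝ) ^ n * (ε / 3) = ε / 3 * 2 ^ n := mul_comm _ _
  linarith

/-- **Registered stub `stub_spectralLevel`**: verbatim `liouville_orthogonal_of_tailWeight_level`. -/
theorem stub_spectralLevel {c : ℝ} (hc : 0 < c) (hB : ∀ᶠ n : ℕ in atTop, ∀ A : Finset (Fin n), |∑ x ∈ range (2 ^ n), (ArithmeticFunction.liouville x : ℝ) * walsh A (fun j : Fin n => x.testBit j)| ≤ (2 : ℝ) ^ ((n : ℝ) - (n : ℝ) ^ c)) {R : ℕ} (hR1 : 1 ≤ R) (hRc : 3 ≤ (R : ℝ) * c) : ∀ ε : ℝ, 0 < ε → ∀ᶠ n : ℕ in atTop, ∀ F : (Fin n → Bool) → Bool, tailWeight (fun x : Fin n → Bool => sgn (F x)) (⌊((n : ℝ)) ^ ((1 : ℝ) / R)⌋₊ + 1) ≤ (ε / 3) ^ 2 → |∑ N ∈ Finset.range (2 ^ n), ((ArithmeticFunction.liouville N : ℤ) : ℝ) * sgn (F (fun i : Fin n => Nat.testBit N i))| ≤ ε * (2 : ℝ) ^ n :=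
  liouville_orthogonal_of_tailWeight_level hc hB hR1 hRc

end Summit.QuantumAdvantage.QuantumAdvantage.Theorems.LiouvilleOrthogonalTC0
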